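import Literature.NumberTheory.Automorphic.SupercuspTypeCuspidalImage
import HarnessLib

/-!
# Vanishing unipotent averages split along an idempotent adele
(Jacquet–Langlands, LNM 114 (1970), §16, p. 503; Arthur–Clozel (1989), Ch. 1, Lemma 2.4: the
hypothesis "`f_{v₁}` is a coefficient of a supercuspidal representation" is a condition at ONE
place, while the cuspidality of `R(f) φ` is a statement about the integral over all of
`N(K) \ N(𝔸)`)

Topic `NumberTheory/Automorphic`; theorems only (no definition, no named fact, no instance visible
to importers). Continuation of `SupercuspTypeCuspidalImage`, where the integrated operator `R(η)`
of the regular representation of `GL_n(𝔸_K)` on `L²(GL_n(𝔸_K) ⧸ A_G GL_n(K))` was shown to have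
cuspidal image as soon as `η ∈ C_c(GL_n(𝔸_K))` satisfies the *global* hypothesis

  `(H_k)  ∫_{𝔫_k(𝔸_K)} η(p (1 + Y) r) dY = 0` for all `p, r ∈ GL_n(𝔸_K)`.

In the sources the hypothesis is *local*: one factor of a factorizable test function is a
supercusp form. This file performs the measure-theoretic half of the passage from local to global,
in a form that does not presuppose any particular construction of factorizable test functions: for
an **idempotent adele** `e` (`e² = e`; e.g. the indicator of one finite place, or of a finite set
of places), entrywise multiplication by `e` and by `1 - e` (`blockScale`, `BlockUnipotentDomains`)
splits the additive group `V = 𝔫_k(𝔸_K)` of block-nilpotent adelic matrices as a topological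
direct sum `V = V₁ ⊕ V₂`, `V₁ = e V`, `V₂ = (1 - e) V`, and since `𝔫_k² = 0` one has
`1 + (Y₁ + Y₂) = (1 + Y₁)(1 + Y₂)`. Hence:

* `blockScale_add`, `blockScale_self_of_mem_range`, `blockScale_eq_zero_of_mem_range`,
  `range_blockScale_eq_ker`, `isClosed_range_blockScale` — the algebra and topology of the two
  complementary idempotent endomorphisms `P = blockScale e`, `Q = blockScale (1 - e)`
  (`P + Q = 1`, `P Q = 0`, `range P = ker Q` is closed).
* `integral_comp_glUnipotent_eq_zero_of_idempotent` — **if the unipotent averages of `η` over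
  the `e`-part vanish, `∫_{V₁} η(p (1 + Y₁) r) dα₁(Y₁) = 0` for all `p, r ∈ GL_n(𝔸_K)` and a Haar
  measure `α₁` of the closed subgroup `V₁ = e 𝔫_k(𝔸_K)`, then `(H_k)` holds for every Haar measure
  of `𝔫_k(𝔸_K)`.** Proof: the continuous additive isomorphism `V₁ × V₂ ≃ V`, `(Y₁, Y₂) ↦ Y₁ + Y₂`
  (inverse `Y ↦ (eY, (1 - e)Y)`) carries any Haar measure of `V` to a multiple of `α₁ ⊗ α₂`
  (uniqueness of Haar measure, Mathlib `isAddLeftInvariant_eq_smul`); by Fubini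
  `∫_V η(p (1 + Y) r) dY = c ∫_{V₂} (∫_{V₁} η(p (1 + Y₁) ((1 + Y₂) r)) dα₁) dα₂ = 0`.
* `integratedOperator_rightRegular_mem_cuspidalSubspace_of_idempotent` — consequently, for
  `η ∈ C_c(GL_n(𝔸_K))` whose `e_k`-partial unipotent averages vanish for every `0 < k < n` (with
  possibly different idempotents `e_k`), `R(η)` maps `L²` into `L²_cusp`, kills `L²_cuspᗮ` and
  factors through the projection onto `L²_cusp`
  (`SupercuspTypeCuspidalImage.integratedOperator_rightRegular_mem_cuspidalSubspace` etc.).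

What remains for the printed local hypothesis is the dictionary, for `e = e_w` the indicator of a
single finite place `w`, between `e_w 𝔫_k(𝔸_K)` with its Haar measure and `𝔫_k(K_w)` (through
`GLn.ofLocal`), and the local theorem that matrix coefficients of supercuspidal representations of
`GL_n(K_w)` have vanishing integrals along `N_k(K_w)` (Harish-Chandra; in the tree
`coinvariantsKer_eq_top_of_isSupercuspidal`); neither is part of this file.

## References

* H. Jacquet, R. P. Langlands, *Automorphic forms on `GL(2)`*, LNM 114 (1970), §16, p. 503
  [JacquetLanglands1970].
* J. Arthur, L. Clozel, *Simple algebras, base change, and the advanced theory of the trace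
  formula*, Ann. of Math. Studies 120 (1989), Ch. 1, Lemma 2.4, pp. 18–20 [ArthurClozel1989].
-/

noncomputable section

open MeasureTheory Measure Set Filter Topology IsDedekindDomain NumberField
open CompactlySupported
open scoped ENNReal NNReal Pointwise

namespace Literature.NumberTheory.Automorphic

/-! ### Complementary idempotents on `𝔫_k(𝔸_K)` -/

section Idempotent

variable {n k : ℕ} {K : Type} [Field K] [NumberField K]

/-- `blockScale` is additive in the scalar: `(a + b) • X = a • X + b • X`. [folklore] -/
theorem blockScale_add (a b : AdeleRing (𝓞 K) K) (X : blockNilpotent n k (AdeleRing (𝓞 K) K)) :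
    blockScale (a + b) X = blockScale a X + blockScale b X :=
  Subtype.ext (add_smul a b (X : Matrix (Fin n) (Fin n) (AdeleRing (𝓞 K) K)))

/-- `blockScale 0 = 0`. [folklore] -/
@[simp]
theorem blockScale_zero_left (X : blockNilpotent n k (AdeleRing (𝓞 K) K)) : blockScale 0 X = 0 :=
  Subtype.ext (zero_smul _ (X : Matrix (Fin n) (Fin n) (AdeleRing (𝓞 K) K)))

/-- `e X + (1 - e) X = X`. [folklore] -/
theorem blockScale_add_blockScale_one_sub (e : AdeleRing (𝓞 K) K)
    (X : blockNilpotent n k (AdeleRing (𝓞 K) K)) :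
    blockScale e X + blockScale (1 - e) X = X := by
  rw [← blockScale_add, add_sub_cancel, blockScale_one]

/-- For an idempotent `e`: `e (e X) = e X`. [folklore] -/
theorem blockScale_blockScale_of_isIdempotentElem {e : AdeleRing (𝓞 K) K} (he : IsIdempotentElem e)
    (X : blockNilpotent n k (AdeleRing (𝓞 K) K)) :
    blockScale e (blockScale e X) = blockScale e X := by
  rw [blockScale_blockScale, he.eq]

/-- For an idempotent `e`: `(1 - e) (e X) = 0`. [folklore] -/
theorem blockScale_one_sub_blockScale {e : AdeleRing (𝓞 K) K} (he : IsIdempotentElem e)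
    (X : blockNilpotent n k (AdeleRing (𝓞 K) K)) :
    blockScale (1 - e) (blockScale e X) = 0 := by
  rw [blockScale_blockScale, sub_mul, one_mul, he.eq, sub_self, blockScale_zero_left]

/-- For an idempotent `e`: `e ((1 - e) X) = 0`. [folklore] -/
theorem blockScale_blockScale_one_sub {e : AdeleRing (𝓞 K) K} (he : IsIdempotentElem e)
    (X : blockNilpotent n k (AdeleRing (𝓞 K) K)) :
    blockScale e (blockScale (1 - e) X) = 0 := by
  rw [blockScale_blockScale, mul_sub, mul_one, he.eq, sub_self, blockScale_zero_left]

/-- On its range the idempotent `blockScale e` is the identity. [folklore] -/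
theorem blockScale_self_of_mem_range {e : AdeleRing (𝓞 K) K} (he : IsIdempotentElem e)
    {X : blockNilpotent n k (AdeleRing (𝓞 K) K)} (hX : X ∈ (blockScale (n := n) (k := k) e).range) :
    blockScale e X = X := by
  obtain ⟨Y, rfl⟩ := hX
  exact blockScale_blockScale_of_isIdempotentElem he Y

/-- The idempotent `blockScale e` kills the range of the complementary idempotent. [folklore] -/
theorem blockScale_eq_zero_of_mem_range {e : AdeleRing (𝓞 K) K} (he : IsIdempotentElem e)
    {X : blockNilpotent n k (AdeleRing (𝓞 K) K)}
    (hX : X ∈ (blockScale (n := n) (k := k) (1 - e)).range) : blockScale e X = 0 := by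
  obtain ⟨Y, rfl⟩ := hX
  exact blockScale_blockScale_one_sub he Y

/-- `range (e ·) = ker ((1 - e) ·)` for an idempotent `e`. [folklore] -/
theorem range_blockScale_eq_ker {e : AdeleRing (𝓞 K) K} (he : IsIdempotentElem e) :
    ((blockScale (n := n) (k := k) e).range : Set (blockNilpotent n k (AdeleRing (𝓞 K) K))) =
      (blockScale (n := n) (k := k) (1 - e)).ker := by
  ext X
  simp only [SetLike.mem_coe, AddMonoidHom.mem_ker]
  constructor
  · rintro ⟨Y, rfl⟩
    exact blockScale_one_sub_blockScale he Y
  · intro hX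
    refine ⟨X, ?_⟩
    have h := blockScale_add_blockScale_one_sub e X
    rwa [hX, add_zero] at h

/-- The range of the idempotent `blockScale e` is closed (it is the kernel of the continuous
`blockScale (1 - e)`). [folklore] -/
theorem isClosed_range_blockScale {e : AdeleRing (𝓞 K) K} (he : IsIdempotentElem e) :
    IsClosed ((blockScale (n := n) (k := k) e).range : Set (blockNilpotent n k (AdeleRing (𝓞 K) K))) := by
  haveI : T2Space (blockNilpotent n k (AdeleRing (𝓞 K) K)) := t2Space_blockNilpotent n k K
  rw [range_blockScale_eq_ker he]
  exact isClosed_singleton.preimage (continuous_blockScale (1 - e))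

end Idempotent

/-! ### Splitting the unipotent averages -/

section Splitting

variable {n k : ℕ} {K : Type} [Field K] [NumberField K]

attribute [local instance] adelicBorel borelSpace_adelic locallyCompactSpace_adelic
  secondCountableTopology_gl_adelic

/-- **Vanishing unipotent averages split along an idempotent adele.** Let `e ∈ 𝔸_K` be idempotent,
`V₁ = e 𝔫_k(𝔸_K)` the (closed) range of entrywise multiplication by `e` on the block-nilpotent
matrices with a Haar measure `α₁`, and `η ∈ C_c(GL_n(𝔸_K))` with
`∫_{V₁} η(p (1 + Y₁) r) dα₁(Y₁) = 0` for all `p, r ∈ GL_n(𝔸_K)`. Then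
`∫_{𝔫_k(𝔸_K)} η(p (1 + Y) r) dν(Y) = 0` for every Haar measure `ν` of `𝔫_k(𝔸_K)` and all `p, r`.
Proof: `(Y₁, Y₂) ↦ Y₁ + Y₂ : V₁ × V₂ ≃ 𝔫_k(𝔸_K)` (`V₂ = (1 - e) 𝔫_k(𝔸_K)`, inverse
`Y ↦ (eY, (1 - e)Y)`) is an isomorphism of topological groups, so `ν` corresponds to a multiple of
`α₁ ⊗ α₂` (uniqueness of Haar measure); `1 + (Y₁ + Y₂) = (1 + Y₁)(1 + Y₂)` as `𝔫_k² = 0`; and by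
Fubini the integral is `c ∫_{V₂} ∫_{V₁} η(p (1 + Y₁) ((1 + Y₂) r)) dα₁ dα₂ = 0`. (The
measure-theoretic half of the passage from "supercusp form at one place" to the global vanishing
used in Jacquet–Langlands (1970), p. 503 and Arthur–Clozel (1989), Ch. 1, Lemma 2.4.)
[cite: ArthurClozel1989, Ch. 1 Lemma 2.4] -/
theorem integral_comp_glUnipotent_eq_zero_of_idempotent {e : AdeleRing (𝓞 K) K}
    (he : IsIdempotentElem e) {η : (AdelicGroupData.gl n K).Adelic → ℂ} (hη : Continuous η)
    (hηs : HasCompactSupport η)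
    (α₁ : Measure (blockScale (n := n) (k := k) e).range) [α₁.IsAddHaarMeasure]
    (h0 : ∀ p r : (AdelicGroupData.gl n K).Adelic,
      ∫ Y₁ : (blockScale (n := n) (k := k) e).range,
        η (p * glUnipotent n k K (Multiplicative.ofAdd
          (Y₁ : blockNilpotent n k (AdeleRing (𝓞 K) K))) * r) ∂α₁ = 0)
    (ν : Measure (blockNilpotent n k (AdeleRing (𝓞 K) K))) [ν.IsAddHaarMeasure]
    (p r : (AdelicGroupData.gl n K).Adelic) :
    ∫ Y, η (p * glUnipotent n k K (Multiplicative.ofAdd Y) * r) ∂ν = 0 := by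
  -- notation and instances
  haveI : T2Space (blockNilpotent n k (AdeleRing (𝓞 K) K)) := t2Space_blockNilpotent n k K
  haveI : LocallyCompactSpace (blockNilpotent n k (AdeleRing (𝓞 K) K)) :=
    locallyCompactSpace_blockNilpotent n k K
  haveI : SecondCountableTopology (blockNilpotent n k (AdeleRing (𝓞 K) K)) :=
    secondCountableTopology_blockNilpotent n k K
  have he' : IsIdempotentElem (1 - e) := he.one_sub
  have hV₁c : IsClosed (((blockScale (n := n) (k := k) e).range : AddSubgroup _) : Set (blockNilpotent n k (AdeleRing (𝓞 K) K))) :=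
    isClosed_range_blockScale he
  have hV₂c : IsClosed (((blockScale (n := n) (k := k) (1 - e)).range : AddSubgroup _) : Set (blockNilpotent n k (AdeleRing (𝓞 K) K))) :=
    isClosed_range_blockScale he'
  haveI : LocallyCompactSpace (blockScale (n := n) (k := k) e).range := hV₁c.isClosedEmbedding_subtypeVal.locallyCompactSpace
  haveI : LocallyCompactSpace (blockScale (n := n) (k := k) (1 - e)).range := hV₂c.isClosedEmbedding_subtypeVal.locallyCompactSpace
  haveI : SecondCountableTopology (blockScale (n := n) (k := k) e).range := TopologicalSpace.Subtype.secondCountableTopology _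
  haveI : SecondCountableTopology (blockScale (n := n) (k := k) (1 - e)).range := TopologicalSpace.Subtype.secondCountableTopology _
  haveI : BorelSpace (blockScale (n := n) (k := k) e).range := Subtype.borelSpace _
  haveI : BorelSpace (blockScale (n := n) (k := k) (1 - e)).range := Subtype.borelSpace _
  haveI : BorelSpace ((blockScale (n := n) (k := k) e).range × (blockScale (n := n) (k := k) (1 - e)).range) := Prod.borelSpace
  -- the splitting isomorphism `(Y₁, Y₂) ↦ Y₁ + Y₂`
  let Φ : (blockScale (n := n) (k := k) e).range × (blockScale (n := n) (k := k) (1 - e)).range ≃+ blockNilpotent n k (AdeleRing (𝓞 K) K) :=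
    { toFun := fun z => (z.1 : blockNilpotent n k (AdeleRing (𝓞 K) K)) + z.2
      invFun := fun X => (⟨blockScale e X, X, rfl⟩, ⟨blockScale (1 - e) X, X, rfl⟩)
      left_inv := by
        rintro ⟨⟨Y₁, hY₁⟩, ⟨Y₂, hY₂⟩⟩
        refine Prod.ext (Subtype.ext ?_) (Subtype.ext ?_)
        · change blockScale e (Y₁ + Y₂) = Y₁
          rw [map_add, blockScale_self_of_mem_range he hY₁, blockScale_eq_zero_of_mem_range he hY₂,
            add_zero]
        · change blockScale (1 - e) (Y₁ + Y₂) = Y₂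
          rw [map_add, blockScale_self_of_mem_range he' hY₂]
          have h1 : blockScale (1 - e) Y₁ = 0 := by
            have hY₁' : Y₁ ∈ (blockScale (n := n) (k := k) (1 - (1 - e))).range := by
              rwa [sub_sub_cancel]
            exact blockScale_eq_zero_of_mem_range he' hY₁'
          rw [h1, zero_add]
      right_inv := fun X => blockScale_add_blockScale_one_sub e X
      map_add' := fun z z' => by
        simp only [Prod.fst_add, Prod.snd_add, AddSubgroup.coe_add]
        abel }
  have hΦ_apply : ∀ z : (blockScale (n := n) (k := k) e).range × (blockScale (n := n) (k := k) (1 - e)).range,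
      Φ z = (z.1 : blockNilpotent n k (AdeleRing (𝓞 K) K)) + z.2 := fun _ => rfl
  have hΦc : Continuous Φ :=
    (continuous_subtype_val.comp continuous_fst).add (continuous_subtype_val.comp continuous_snd)
  have hΦsc : Continuous Φ.symm := by
    change Continuous fun X : blockNilpotent n k (AdeleRing (𝓞 K) K) =>
      ((⟨blockScale e X, X, rfl⟩ : (blockScale (n := n) (k := k) e).range),
        (⟨blockScale (1 - e) X, X, rfl⟩ : (blockScale (n := n) (k := k) (1 - e)).range))
    exact ((continuous_blockScale e).subtype_mk _).prodMk ((continuous_blockScale (1 - e)).subtype_mk _)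
  have hme : MeasurableEmbedding Φ :=
    (Homeomorph.mk Φ.toEquiv hΦc hΦsc).measurableEmbedding
  -- Haar measures: `ν` corresponds to a multiple of `α₁ ⊗ α₂`
  haveI : SigmaCompactSpace (blockScale (n := n) (k := k) e).range :=
    sigmaCompactSpace_of_locallyCompact_secondCountable
  haveI : SigmaCompactSpace (blockScale (n := n) (k := k) (1 - e)).range :=
    sigmaCompactSpace_of_locallyCompact_secondCountable
  set α₂ : Measure (blockScale (n := n) (k := k) (1 - e)).range := Measure.addHaar with hα₂
  haveI : SigmaFinite α₁ := inferInstance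
  haveI : SigmaFinite α₂ := inferInstance
  set ν' : Measure ((blockScale (n := n) (k := k) e).range × (blockScale (n := n) (k := k) (1 - e)).range) := Measure.map Φ.symm ν with hν'
  haveI : ν'.IsAddHaarMeasure := Φ.symm.isAddHaarMeasure_map ν hΦsc hΦc
  have hνeq : ν' = ν'.addHaarScalarFactor (α₁.prod α₂) • α₁.prod α₂ :=
    isAddLeftInvariant_eq_smul ν' (α₁.prod α₂)
  -- the integrand and its transport
  set G : blockNilpotent n k (AdeleRing (𝓞 K) K) → ℂ :=
    fun Y => η (p * glUnipotent n k K (Multiplicative.ofAdd Y) * r) with hG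
  have hGc : Continuous G := continuous_comp_glUnipotent hη p r
  have hGs : HasCompactSupport G := hasCompactSupport_comp_glUnipotent hηs p r
  have hmap : Measure.map Φ ν' = ν := by
    have hm : Measurable Φ := hΦc.measurable
    have hsm : Measurable Φ.symm := hΦsc.measurable
    rw [hν', Measure.map_map hm hsm]
    have : (Φ : (blockScale (n := n) (k := k) e).range × (blockScale (n := n) (k := k) (1 - e)).range →
        blockNilpotent n k (AdeleRing (𝓞 K) K)) ∘ Φ.symm = id :=
      funext fun X => Φ.apply_symm_apply X
    rw [this, Measure.map_id]
  have h1 : ∫ Y, G Y ∂ν = ∫ z, G (Φ z) ∂ν' := by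
    rw [← hmap, hme.integral_map]
  rw [h1, hνeq, integral_smul_nnreal_measure]
  -- Fubini on `V₁ × V₂`
  have hGi : Integrable (fun z : (blockScale (n := n) (k := k) e).range × (blockScale (n := n) (k := k) (1 - e)).range => G (Φ z)) (α₁.prod α₂) :=
    (hGc.comp hΦc).integrable_of_hasCompactSupport (hGs.comp_homeomorph (Homeomorph.mk Φ.toEquiv hΦc hΦsc))
  rw [integral_prod_symm _ hGi]
  -- the inner integral vanishes: `1 + (Y₁ + Y₂) = (1 + Y₁) (1 + Y₂)`
  have hinner : ∀ Y₂ : (blockScale (n := n) (k := k) (1 - e)).range, ∫ Y₁ : (blockScale (n := n) (k := k) e).range, G (Φ (Y₁, Y₂)) ∂α₁ = 0 := by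
    intro Y₂
    have h2 : ∀ Y₁ : (blockScale (n := n) (k := k) e).range, G (Φ (Y₁, Y₂)) =
        η (p * glUnipotent n k K (Multiplicative.ofAdd (Y₁ : blockNilpotent n k (AdeleRing (𝓞 K) K))) *
          (glUnipotent n k K (Multiplicative.ofAdd (Y₂ : blockNilpotent n k (AdeleRing (𝓞 K) K))) * r)) := by
      intro Y₁
      simp only [hG, hΦ_apply, ← glUnipotent_ofAdd_mul, mul_assoc]
    simp_rw [h2]
    exact h0 p _
  simp_rw [hinner]
  rw [integral_zero, smul_zero]

end Splitting

/-! ### Cuspidal image of `R(η)` from partial unipotent averages -/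

section Cuspidal

variable {n : ℕ} {K : Type} [Field K] [NumberField K]
  {μ : Measure (AdelicGroupData.gl n K).automorphicQuotient}
  [(AdelicGroupData.gl n K).IsAutomorphicMeasure μ]

attribute [local instance] adelicBorel borelSpace_adelic locallyCompactSpace_adelic
  secondCountableTopology_gl_adelic

/-- **`R(η)` has cuspidal image when, for each `0 < k < n`, the unipotent averages of `η` over
the `e_k`-part of `𝔫_k(𝔸_K)` vanish** for some idempotent adeles `e_k` (e.g. indicators of
finite places where a factor of `η` is a supercusp form): `R(η) f ∈ L²_cusp` for every `f ∈ L²`,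
`R(η)` kills `L²_cuspᗮ` and `R(η) = R(η) ∘ P_cusp`
(`integral_comp_glUnipotent_eq_zero_of_idempotent` with
`SupercuspTypeCuspidalImage.integratedOperator_rightRegular_mem_cuspidalSubspace`,
`…_eq_zero_of_mem_orthogonal`, `…_eq_comp_starProjection`). Jacquet–Langlands (1970), p. 503;
Arthur–Clozel (1989), Ch. 1, Lemma 2.4. [cite: ArthurClozel1989, Ch. 1 Lemma 2.4] -/
theorem integratedOperator_rightRegular_mem_cuspidalSubspace_of_idempotent
    {η : C_c((AdelicGroupData.gl n K).Adelic, ℂ)} (e : ℕ → AdeleRing (𝓞 K) K)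
    (he : ∀ k, 0 < k → k < n → IsIdempotentElem (e k))
    (α : ∀ k, Measure (blockScale (n := n) (k := k) (e k)).range)
    (hα : ∀ k, 0 < k → k < n → (α k).IsAddHaarMeasure)
    (h0 : ∀ k, 0 < k → k < n → ∀ p r : (AdelicGroupData.gl n K).Adelic,
      ∫ Y₁ : (blockScale (n := n) (k := k) (e k)).range,
        η (p * glUnipotent n k K (Multiplicative.ofAdd
          (Y₁ : blockNilpotent n k (AdeleRing (𝓞 K) K))) * r) ∂(α k) = 0)
    (ν : Measure (AdelicGroupData.gl n K).Adelic) [ν.IsHaarMeasure] [ν.IsInvInvariant] :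
    (∀ f : (AdelicGroupData.gl n K).L2 μ,
      ((AdelicGroupData.gl n K).rightRegular μ).integratedOperator
          ((AdelicGroupData.gl n K).isUnitary_rightRegular μ)
          ((AdelicGroupData.gl n K).isStronglyContinuous_rightRegular_holds μ) ν η f ∈
        cuspidalSubspace n K μ) ∧
    (∀ f : (AdelicGroupData.gl n K).L2 μ, f ∈ (cuspidalSubspace n K μ).toSubmoduleᗮ →
      ((AdelicGroupData.gl n K).rightRegular μ).integratedOperator
          ((AdelicGroupData.gl n K).isUnitary_rightRegular μ)
          ((AdelicGroupData.gl n K).isStronglyContinuous_rightRegular_holds μ) ν η f = 0) ∧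
    ((AdelicGroupData.gl n K).rightRegular μ).integratedOperator
        ((AdelicGroupData.gl n K).isUnitary_rightRegular μ)
        ((AdelicGroupData.gl n K).isStronglyContinuous_rightRegular_holds μ) ν η =
      (((AdelicGroupData.gl n K).rightRegular μ).integratedOperator
        ((AdelicGroupData.gl n K).isUnitary_rightRegular μ)
        ((AdelicGroupData.gl n K).isStronglyContinuous_rightRegular_holds μ) ν η).comp
        (cuspidalSubspace n K μ).toSubmodule.starProjection := by
  have hH : ∀ k, 0 < k → k < n →
      ∀ (ν𝔫 : Measure (blockNilpotent n k (AdeleRing (𝓞 K) K))) [ν𝔫.IsAddHaarMeasure]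
        (p r : (AdelicGroupData.gl n K).Adelic),
        ∫ Y, η (p * glUnipotent n k K (Multiplicative.ofAdd Y) * r) ∂ν𝔫 = 0 := by
    intro k hk hkn ν𝔫 _ p r
    haveI := hα k hk hkn
    exact integral_comp_glUnipotent_eq_zero_of_idempotent (he k hk hkn) η.continuous
      η.hasCompactSupport (α k) (h0 k hk hkn) ν𝔫 p r
  exact ⟨fun f => integratedOperator_rightRegular_mem_cuspidalSubspace hH ν f,
    fun f hf => integratedOperator_rightRegular_eq_zero_of_mem_orthogonal hH ν hf,
    integratedOperator_rightRegular_eq_comp_starProjection hH ν⟩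

end Cuspidal

end Literature.NumberTheory.Automorphic
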